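import Summits.CriticalPhenomena.PercolationContinuityZ3.Theorems.PercNearOneGluingNoHeavyLowerTailSahiSlotHarrisSlackCert

/-!
# Point evaluations are sums of cut edges: `x(p) = x(⊥) + Σ_{path} (x(q + e_a) − x(q))` on the slot cube `[3]^d` (every `d`)

Support file of the one-cut programme (crux `NoHeavyLowerTail`, stmt-CriticalPhenomena-4575; cell `prim-masterthm`, seat P3, gen 22;
`run/shared/lean/prim/prim-masterthm/prim-masterthm-p3/HIERARCHY.md` §30).  Pure, no definitions, standard axioms.

Infrastructure for literal-product certificates (`SahiSlot.Lit`, `LitProdCert` / `PinnedLitCert` / `PairLitCert`): the literal cone is generated by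
`x_⊥` and the cut edges, and a POINT EVALUATION `x ↦ x(p)` is in it — along any monotone lattice path from `⊥` to `p` the cut edges telescope.  This file
gives the explicit finite version used when a cell certificate containing the literal `x_⊥` of the CELL is lifted to a cylinder (the cell's bottom at a
free point `ξ ≠ ⊥` is the point `(⊥_cell, ξ)` of the big cube, cf. memo FROM-prim-masterthm-p3-g22 §8.5):
**`exists_path_bumps`** — for every `p ∈ [3]^d` a finite list of (base point, direction) pairs `(ω_t, a_t)` with `ω_t(a_t) < 2` such that for ALL `x`,
`x(p) = x(⊥) + Σ_t (x(bump ω_t a_t) − x(ω_t))` (the path raises the coordinates one after the other), and its literal form **`exists_path_lits`**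
(`x(p) − x(⊥) = Σ_t ℓ_t(x)` with cut-edge literals `ℓ_t : Lit d 3`). [this work]
-/

noncomputable section

namespace Summit.CriticalPhenomena.PercolationContinuityZ3.Theorems

open Finset Function

namespace SahiSlot

section PathEval

variable {d : ℕ}

/-- On the chain `[3]`: `x(j) − x(0)` is the sum of the cut edges below `j` — as an explicit finite family over `Fin 3` with `0/1` multiplicities.
[this work] -/
theorem chain3_telescope (f : Fin 3 → ℝ) (j : Fin 3) :
    f j - f 0 = ∑ v : Fin 3, (if (v : ℕ) < (j : ℕ) then f (succ3 v) - f v else 0) := by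
  have s0 : succ3 0 = 1 := by decide
  have s1 : succ3 1 = 2 := by decide
  fin_cases j <;> simp [Fin.sum_univ_three, s0, s1]

/-- **Point evaluations are sums of cut edges (explicit path)**: for every point `p` of `[3]^d` there are finitely many pairs `(ω_t, a_t)` with
`ω_t(a_t) < 2` and nonnegative multiplicities `c_t ∈ {0,1}` such that `x(p) = x(⊥) + Σ_t c_t·(x(bump ω_t a_t) − x(ω_t))` for all `x`. [this work] -/
theorem exists_path_bumps (d : ℕ) (p : Q d 3) :
    ∃ (ι : Type) (_ : Fintype ι) (c : ι → ℝ) (ω : ι → Q d 3) (a : ι → Fin d),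
      (∀ t, 0 ≤ c t) ∧ (∀ t, ((ω t (a t) : ℕ)) + 1 < 3) ∧
      ∀ x : Q d 3 → ℝ, x p = x (fun _ => 0) + ∑ t, c t * (x (bump (ω t) (a t)) - x (ω t)) := by
  induction d with
  | zero =>
    refine ⟨Empty, inferInstance, Empty.elim, Empty.elim, Empty.elim, fun t => t.elim, fun t => t.elim, fun x => ?_⟩
    have hp : p = fun _ => 0 := funext fun a => a.elim0
    simp [hp]
  | succ d ih =>
    -- p = snoc p' j
    obtain ⟨ι, hι, c, ω, a, hc, hω, hid⟩ := ih (Fin.init p)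
    let j : Fin 3 := p (Fin.last d)
    have hp : p = Fin.snoc (Fin.init p) j := (Fin.snoc_init_self p).symm
    -- vertical steps at the base `snoc (init p) v`, v = 0, 1 (used iff v < j), then the horizontal path inside layer 0
    let lev : Fin 2 → Fin 3 := fun i => ⟨i, by omega⟩
    refine ⟨ι ⊕ Fin 2, inferInstance,
      Sum.elim c (fun v => if (v : ℕ) < (j : ℕ) then 1 else 0),
      Sum.elim (fun t => Fin.snoc (ω t) 0) (fun v => Fin.snoc (Fin.init p) (lev v)),
      Sum.elim (fun t => Fin.castSucc (a t)) (fun _ => Fin.last d), ?_, ?_, fun x => ?_⟩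
    · rintro (t | v)
      · exact hc t
      · simp only [Sum.elim_inr]; split_ifs <;> norm_num
    · rintro (t | v)
      · simp only [Sum.elim_inl, Fin.snoc_castSucc]; exact hω t
      · simp only [Sum.elim_inr, Fin.snoc_last]; show (v : ℕ) + 1 < 3; omega
    · rw [Fintype.sum_sum_type]
      simp only [Sum.elim_inl, Sum.elim_inr, bump_snoc_castSucc, bump_snoc_last]
      -- horizontal part: the induction hypothesis for the layer-0 restriction
      have h0 := hid (fun q => x (Fin.snoc q 0))
      -- vertical part: telescope on the chain over the base `init p`
      have hv := chain3_telescope (fun v => x (Fin.snoc (Fin.init p) v)) j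
      have hvsum : (∑ v : Fin 2, (if (v : ℕ) < (j : ℕ) then (1:ℝ) else 0) *
            (x (Fin.snoc (Fin.init p) (succ3 (lev v))) - x (Fin.snoc (Fin.init p) (lev v)))) =
          ∑ v : Fin 3, (if (v : ℕ) < (j : ℕ) then x (Fin.snoc (Fin.init p) (succ3 v)) - x (Fin.snoc (Fin.init p) v) else 0) := by
        rw [Fin.sum_univ_two, Fin.sum_univ_three]
        have l0 : lev 0 = 0 := rfl
        have l1 : lev 1 = 1 := rfl
        have hj2 : ¬ ((2 : ℕ) < (j : ℕ)) := by have := j.isLt; omega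
        simp only [l0, l1, Fin.val_zero, Fin.val_one, show ((2 : Fin 3) : ℕ) = 2 from rfl, hj2, if_false, add_zero]
        split_ifs <;> ring
      rw [hvsum, ← hv]
      have hbot : (Fin.snoc (fun _ : Fin d => (0 : Fin 3)) 0 : Q (d + 1) 3) = fun _ => 0 := by
        funext b; refine Fin.lastCases ?_ (fun i => ?_) b
        · simp only [Fin.snoc_last]
        · simp only [Fin.snoc_castSucc]
      rw [hbot] at h0
      conv_lhs => rw [hp]
      linarith [h0]

/-- **Literal form**: `x(p) − x(⊥) = Σ_t c_t · ℓ_t(x)` with cut-edge literals `ℓ_t` and `c_t ≥ 0` — point evaluations lie in the literal cone,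
explicitly. [this work] -/
theorem exists_path_lits (d : ℕ) (p : Q d 3) :
    ∃ (k : ℕ) (c : Fin k → ℝ) (J : Fin k → Lit d 3), (∀ t, 0 ≤ c t) ∧
      ∀ x : Q d 3 → ℝ, x p - x (fun _ => 0) = ∑ t, c t * (J t).eval x := by
  obtain ⟨ι, hι, c, ω, a, hc, hω, hid⟩ := exists_path_bumps d p
  classical
  let e : ι ≃ Fin (Fintype.card ι) := Fintype.equivFin ι
  refine ⟨Fintype.card ι, fun t => c (e.symm t), fun t => Lit.cover (ω (e.symm t)) (a (e.symm t)), fun t => hc _, fun x => ?_⟩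
  rw [hid x, ← e.symm.sum_comp]
  simp only [add_sub_cancel_left]
  refine Fintype.sum_congr _ _ fun t => ?_
  rw [Lit.eval_cover_eq_bump _ _ (hω _)]

end PathEval

end SahiSlot

end Summit.CriticalPhenomena.PercolationContinuityZ3.Theorems
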